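import Mathlib.RepresentationTheory.Homological.GroupCohomology.Functoriality
import Mathlib.RepresentationTheory.Homological.Resolution
import Mathlib.Algebra.Homology.Opposite
import HarnessLib

/-!
# Group cohomology computed from any projective resolution, NATURALLY in the coefficients;
# `Hⁿ(G, -)` commutes with directed unions for groups of type `FP_∞`

Topic `Algebra/Homology`; namespace `Literature.Algebra.Homology` (grouping sub-namespace
`ResolutionComparison`).  Definitions with bodies and theorems; Mathlib-only imports; no named
fact, no instance, no `sorry`.

Mathlib computes `groupCohomology A n` (inhomogeneous cochains) from any projective resolution `P`
of the trivial representation `k` (`groupCohomologyIso A n P`, through `Ext`), but records no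
naturality of this isomorphism in `A`.  Here the comparison is rebuilt so that naturality is
available:

* `precomp φ A : Hom(Y_•, A) ⟶ Hom(X_•, A)`, `postcomp X f : Hom(X_•, A) ⟶ Hom(X_•, B)` — the two
  functorialities of the cochain complexes `X.linearYonedaObj k A = Hom(X_•, A)`
  (`precomp_postcomp`: they commute; `precompHomotopy`: homotopic chain maps give homotopic
  precompositions, Mathlib `Functor.mapHomotopy` + `Homotopy.unop`);
* `homologyIsoOfHomotopyEquiv` — `Hⁿ(Hom(Y_•, A)) ≅ Hⁿ(Hom(X_•, A))` along a homotopy equivalence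
  `X ≃ Y`; `inhomogeneousCochainsIso_hom_naturality` — Mathlib's
  `inhomogeneousCochains A ≅ Hom(bar_•, A)` is natural in `A`;
* `resolutionIso P A n : groupCohomology A n ≅ Hⁿ(Hom(P_•, A))` (bar complex ≃ `P`, Mathlib
  `ProjectiveResolution.homotopyEquiv`) and **`resolutionIso_hom_naturality`**:
  `resolutionIso ≫ Hⁿ(postcomp f) = Hⁿ(G, f) ≫ resolutionIso`
  ([Brown1982CohomologyGroups, III.1 and VIII.4: `H^*(Γ, -) = Ext^*_{ℤΓ}(ℤ, -)` computed from any
  projective resolution]);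
* the application to a resolution of FINITE TYPE (`P_n ≅ k[G]^{m_n}`, type `FP_∞`): for a directed
  family of subrepresentations `A_i ↪ B` exhausting `B`,
  **`exists_map_eq_of_directed`** — every class of `Hⁿ(G, B)` comes from some `Hⁿ(G, A_i)` — and
  **`exists_map_eq_zero_of_directed`** — a class of `Hⁿ(G, A_i)` dying in `Hⁿ(G, B)` dies in some
  `Hⁿ(G, A_j)`; i.e. `Hⁿ(G, lim→ A_i) = lim→ Hⁿ(G, A_i)` ([Brown1982CohomologyGroups, VIII (4.6):
  "If `M` is of type `FP_∞` then `Ext*_R(M, -)` commutes with direct limits", (4.7): "If `P` is a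
  finitely generated projective `R`-module then `Hom_R(P, -)` commutes with direct limits";
  [Serre1971CohomologieGroupesDiscrets, §1.8 Remarque]: "les foncteurs `M ↦ H^q(Γ, M)` commutent
  aux limites inductives"), proved in the `Hom(P_•, -)` model (`exists_homologyMap_postcomp_eq`,
  `exists_homologyMap_postcomp_eq_zero`: a morphism `k[G]^m → B` takes its `m` basis values in a
  single `A_i`) and transferred by the naturality above.

Consumers: the Borel–Serre / Raghunathan / Serre finiteness of arithmetic groups is a free
resolution
of finite type; with it these theorems give the comparison of the cohomology of a lattice with that
of the rational / `ℚ̄_p`-representation it spans (needed for the integrality of Hecke eigenvalues on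
`H^q(X_U, Ṽ_λ)`).

## References

* K. S. Brown, *Cohomology of Groups*, GTM 87 (1982), III.1, VIII (4.6)–(4.8)
  [Brown1982CohomologyGroups].
* J.-P. Serre, *Cohomologie des groupes discrets*, Ann. of Math. Studies 70 (1971), §1.8 Remarque
  [Serre1971CohomologieGroupesDiscrets].
-/

noncomputable section

open CategoryTheory Opposite

universe u

namespace Literature.Algebra.Homology

namespace ResolutionComparison

variable {k G : Type u} [CommRing k] [Group G]

/-- The contravariant functor `X ↦ Hom(X, A)` into `(ModuleCat k)ᵒᵖ` (Mathlib `linearYoneda`,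
`rightOp`), whose `mapHomologicalComplex` underlies `ChainComplex.linearYonedaObj`. [folklore] -/
abbrev homFunctor (A : Rep.{u} k G) : Rep.{u} k G ⥤ (ModuleCat.{u} k)ᵒᵖ :=
  ((linearYoneda k (Rep.{u} k G)).obj A).rightOp

/-- Precomposition with a chain map `φ : X ⟶ Y`: the cochain map `Hom(Y_•, A) ⟶ Hom(X_•, A)`
(`g ↦ φ_n ≫ g`). [folklore] -/
def precomp {X Y : ChainComplex (Rep.{u} k G) ℕ} (φ : X ⟶ Y) (A : Rep.{u} k G) :
    Y.linearYonedaObj k A ⟶ X.linearYonedaObj k A :=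
  (HomologicalComplex.unopFunctor (ModuleCat.{u} k) (ComplexShape.down ℕ)).map
    (((homFunctor A).mapHomologicalComplex (ComplexShape.down ℕ)).map φ).op

/-- Components of `precomp`: `g ↦ φ_n ≫ g` (Mathlib `Linear.leftComp`). [folklore] -/
theorem precomp_f {X Y : ChainComplex (Rep.{u} k G) ℕ} (φ : X ⟶ Y) (A : Rep.{u} k G) (n : ℕ) :
    (precomp φ A).f n = ModuleCat.ofHom (Linear.leftComp k A (φ.f n)) := rfl

/-- `precomp` is contravariantly functorial. [folklore] -/
theorem precomp_comp {X Y Z : ChainComplex (Rep.{u} k G) ℕ} (φ : X ⟶ Y) (ψ : Y ⟶ Z)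
    (A : Rep.{u} k G) : precomp (φ ≫ ψ) A = precomp ψ A ≫ precomp φ A := by
  ext n : 1
  rw [HomologicalComplex.comp_f, precomp_f, precomp_f, precomp_f]
  refine ModuleCat.hom_ext (LinearMap.ext fun g => ?_)
  change (φ ≫ ψ).f n ≫ g = φ.f n ≫ (ψ.f n ≫ g)
  rw [HomologicalComplex.comp_f, Category.assoc]

/-- `precomp` of the identity. [folklore] -/
theorem precomp_id (X : ChainComplex (Rep.{u} k G) ℕ) (A : Rep.{u} k G) :
    precomp (𝟙 X) A = 𝟙 _ := by
  ext n : 1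
  rw [precomp_f, HomologicalComplex.id_f]
  refine ModuleCat.hom_ext (LinearMap.ext fun g => ?_)
  change (𝟙 X : X ⟶ X).f n ≫ g = g
  rw [HomologicalComplex.id_f, Category.id_comp]

/-- Homotopic chain maps give homotopic precompositions (Mathlib `Functor.mapHomotopy` for the
additive functor `Hom(-, A)` into `(ModuleCat k)ᵒᵖ`, then `Homotopy.unop`). [folklore] -/
def precompHomotopy {X Y : ChainComplex (Rep.{u} k G) ℕ} {φ₁ φ₂ : X ⟶ Y} (h : Homotopy φ₁ φ₂)
    (A : Rep.{u} k G) : Homotopy (precomp φ₁ A) (precomp φ₂ A) :=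
  ((homFunctor A).mapHomotopy h).unop

/-- Postcomposition with `f : A ⟶ B`: the cochain map `Hom(X_•, A) ⟶ Hom(X_•, B)` (`g ↦ g ≫ f`),
i.e. the functoriality of `X.linearYonedaObj k` in the coefficients. [folklore] -/
def postcomp (X : ChainComplex (Rep.{u} k G) ℕ) {A B : Rep.{u} k G} (f : A ⟶ B) :
    X.linearYonedaObj k A ⟶ X.linearYonedaObj k B :=
  (HomologicalComplex.unopFunctor (ModuleCat.{u} k) (ComplexShape.down ℕ)).map
    ((NatTrans.mapHomologicalComplex (NatTrans.rightOp ((linearYoneda k (Rep.{u} k G)).map f))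
      (ComplexShape.down ℕ)).app X).op

/-- Components of `postcomp`: `g ↦ g ≫ f` (Mathlib `Linear.rightComp`). [folklore] -/
theorem postcomp_f (X : ChainComplex (Rep.{u} k G) ℕ) {A B : Rep.{u} k G} (f : A ⟶ B) (n : ℕ) :
    (postcomp X f).f n = ModuleCat.ofHom (Linear.rightComp k (X.X n) f) := rfl

/-- Precomposition commutes with postcomposition (associativity). [folklore] -/
theorem precomp_postcomp {X Y : ChainComplex (Rep.{u} k G) ℕ} (φ : X ⟶ Y) {A B : Rep.{u} k G}
    (f : A ⟶ B) : precomp φ A ≫ postcomp X f = postcomp Y f ≫ precomp φ B := by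
  ext n : 1
  rw [HomologicalComplex.comp_f, HomologicalComplex.comp_f, precomp_f, precomp_f, postcomp_f,
    postcomp_f]
  refine ModuleCat.hom_ext (LinearMap.ext fun g => ?_)
  change (φ.f n ≫ g) ≫ f = φ.f n ≫ (g ≫ f)
  rw [Category.assoc]

/-- **`Hⁿ(Hom(Y_•, A)) ≅ Hⁿ(Hom(X_•, A))` along a homotopy equivalence `X ≃ Y`** (homotopic maps act
equally on homology, Mathlib `Homotopy.homologyMap_eq`).
[cite: Brown1982CohomologyGroups, I.7 and III.1] -/
def homologyIsoOfHomotopyEquiv {X Y : ChainComplex (Rep.{u} k G) ℕ} (e : HomotopyEquiv X Y)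
    (A : Rep.{u} k G) (n : ℕ) :
    (Y.linearYonedaObj k A).homology n ≅ (X.linearYonedaObj k A).homology n where
  hom := HomologicalComplex.homologyMap (precomp e.hom A) n
  inv := HomologicalComplex.homologyMap (precomp e.inv A) n
  hom_inv_id := by
    rw [← HomologicalComplex.homologyMap_comp, ← precomp_comp,
      (precompHomotopy e.homotopyInvHomId A).homologyMap_eq, precomp_id,
      HomologicalComplex.homologyMap_id]
  inv_hom_id := by
    rw [← HomologicalComplex.homologyMap_comp, ← precomp_comp,
      (precompHomotopy e.homotopyHomInvId A).homologyMap_eq, precomp_id,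
      HomologicalComplex.homologyMap_id]

/-- Naturality of the inverse of Mathlib's `inhomogeneousCochainsIso` in the coefficients
(its components are the evaluations `g ↦ (x ↦ g(single x (single 1 1)))`, which commute with
postcomposition definitionally). [folklore] -/
theorem inhomogeneousCochainsIso_inv_naturality {A B : Rep.{u} k G} (f : A ⟶ B) :
    postcomp (Rep.barComplex k G) f ≫ (groupCohomology.inhomogeneousCochainsIso B).inv =
      (groupCohomology.inhomogeneousCochainsIso A).inv ≫
        groupCohomology.cochainsMap (MonoidHom.id G) f := by
  ext n : 1
  simp only [HomologicalComplex.comp_f, postcomp_f, groupCohomology.inhomogeneousCochainsIso,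
    HomologicalComplex.Hom.isoOfComponents_inv_f, Iso.symm_inv]
  refine ModuleCat.hom_ext (LinearMap.ext fun g => ?_)
  funext x
  rfl

/-- **Naturality of Mathlib's `inhomogeneousCochainsIso A : inhomogeneousCochains A ≅ Hom(bar_•, A)`
in the coefficients `A`.** [folklore] -/
theorem inhomogeneousCochainsIso_hom_naturality {A B : Rep.{u} k G} (f : A ⟶ B) :
    (groupCohomology.inhomogeneousCochainsIso A).hom ≫ postcomp (Rep.barComplex k G) f =
      groupCohomology.cochainsMap (MonoidHom.id G) f ≫
        (groupCohomology.inhomogeneousCochainsIso B).hom := by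
  rw [← cancel_mono (groupCohomology.inhomogeneousCochainsIso B).inv, Category.assoc,
    inhomogeneousCochainsIso_inv_naturality, Iso.hom_inv_id_assoc, Category.assoc, Iso.hom_inv_id,
    Category.comp_id]

/-- The isomorphism on homology induced by an isomorphism of complexes (kept in the
`HomologicalComplex.homologyMap` normal form). [folklore] -/
def homologyIsoOfIso {C D : CochainComplex (ModuleCat.{u} k) ℕ} (e : C ≅ D) (n : ℕ) :
    C.homology n ≅ D.homology n where
  hom := HomologicalComplex.homologyMap e.hom n
  inv := HomologicalComplex.homologyMap e.inv n
  hom_inv_id := by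
    rw [← HomologicalComplex.homologyMap_comp, Iso.hom_inv_id, HomologicalComplex.homologyMap_id]
  inv_hom_id := by
    rw [← HomologicalComplex.homologyMap_comp, Iso.inv_hom_id, HomologicalComplex.homologyMap_id]

/-- Any projective resolution of `k` is homotopy equivalent to the bar complex (Mathlib
`ProjectiveResolution.homotopyEquiv`, with the target written as `Rep.barComplex`).
[cite: Brown1982CohomologyGroups, I (7.5)] -/
def toBarHomotopyEquiv (P : ProjectiveResolution (Rep.trivial k G k)) :
    HomotopyEquiv P.complex (Rep.barComplex k G) :=
  P.homotopyEquiv (Rep.barResolution k G)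

/-- **The comparison `Hⁿ(G, A) ≅ Hⁿ(Hom(P_•, A))` for any projective resolution `P` of the trivial
representation `k`** (inhomogeneous cochains `≅ Hom(bar_•, A)`, and `bar ≃ P`).
[cite: Brown1982CohomologyGroups, III.1 (H^*(G, M) = Ext, any projective resolution)] -/
def resolutionIso (P : ProjectiveResolution (Rep.trivial k G k)) (A : Rep.{u} k G) (n : ℕ) :
    groupCohomology A n ≅ (P.complex.linearYonedaObj k A).homology n :=
  homologyIsoOfIso (groupCohomology.inhomogeneousCochainsIso A) n ≪≫
    homologyIsoOfHomotopyEquiv (toBarHomotopyEquiv P) A n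

/-- **Naturality of `resolutionIso` in the coefficients**: `resolutionIso ≫ Hⁿ(postcomp f) =
Hⁿ(G, f) ≫ resolutionIso` (Mathlib's `groupCohomologyIso` records no such statement).
[cite: Brown1982CohomologyGroups, III.1] -/
theorem resolutionIso_hom_naturality (P : ProjectiveResolution (Rep.trivial k G k))
    {A B : Rep.{u} k G} (f : A ⟶ B) (n : ℕ) :
    (resolutionIso P A n).hom ≫ HomologicalComplex.homologyMap (postcomp P.complex f) n =
      groupCohomology.map (MonoidHom.id G) f n ≫ (resolutionIso P B n).hom := by
  simp only [resolutionIso, Iso.trans_hom, homologyIsoOfIso, homologyIsoOfHomotopyEquiv,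
    groupCohomology.map, groupCohomology, Category.assoc]
  rw [← HomologicalComplex.homologyMap_comp, ← HomologicalComplex.homologyMap_comp,
    ← HomologicalComplex.homologyMap_comp, ← HomologicalComplex.homologyMap_comp]
  congr 1
  rw [precomp_postcomp, ← Category.assoc, inhomogeneousCochainsIso_hom_naturality,
    Category.assoc]


/-! ### Generic element-level lemmas for cochain complexes of modules -/

section ModuleComplex

variable (C D : CochainComplex (ModuleCat.{u} k) ℕ)

/-- `homologyπ` is surjective (it is an epimorphism of modules). [folklore] -/
theorem homologyπ_surjective (n : ℕ) : Function.Surjective (C.homologyπ n) :=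
  (ModuleCat.epi_iff_surjective _).1 inferInstance

/-- `iCycles` is injective (it is a monomorphism of modules). [folklore] -/
theorem iCycles_injective (n : ℕ) : Function.Injective (C.iCycles n) :=
  (ModuleCat.mono_iff_injective _).1 inferInstance

/-- `[z] = 0` iff `z` is a coboundary (`Hⁿ` is the cokernel of `C^{n-1} → Zⁿ`; for `n = 0` the
statement reads `[z] = 0 ↔ z = 0`). [folklore] -/
theorem homologyπ_apply_eq_zero_iff (n : ℕ) (z : C.cycles n) :
    C.homologyπ n z = 0 ↔ ∃ w : C.X (n - 1), C.toCycles (n - 1) n w = z := by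
  have hprev : (ComplexShape.up ℕ).prev n = n - 1 := by
    cases n with
    | zero => exact CochainComplex.prev_nat_zero
    | succ n => exact CochainComplex.prev_nat_succ n
  have hex : (ShortComplex.mk (C.toCycles (n - 1) n) (C.homologyπ n)
      (C.toCycles_comp_homologyπ (n - 1) n)).Exact :=
    ShortComplex.exact_of_g_is_cokernel _ (C.homologyIsCokernel (n - 1) n hprev)
  rw [ShortComplex.moduleCat_exact_iff] at hex
  constructor
  · intro hz
    exact hex z hz
  · rintro ⟨w, rfl⟩
    have h := LinearMap.congr_fun
      (congrArg ModuleCat.Hom.hom (C.toCycles_comp_homologyπ (n - 1) n)) w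
    simpa only [ModuleCat.hom_comp, ModuleCat.hom_zero, LinearMap.comp_apply,
      LinearMap.zero_apply] using h

/-- A cochain with zero coboundary is (the image of) a cocycle (Mathlib `cyclesMk`). [folklore] -/
theorem exists_cycles_of_d_eq_zero (n : ℕ) (x : C.X n) (hx : C.d n (n + 1) x = 0) :
    ∃ z : C.cycles n, C.iCycles n z = x :=
  ⟨C.cyclesMk x (n + 1) (by simp) hx, C.i_cyclesMk x (n + 1) (by simp) hx⟩

variable {C D}

/-- `cyclesMap` acts on cochains through `φ` (Mathlib `cyclesMap_i`, element form). [folklore] -/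
theorem iCycles_cyclesMap (φ : C ⟶ D) (n : ℕ) (z : C.cycles n) :
    D.iCycles n (HomologicalComplex.cyclesMap φ n z) = φ.f n (C.iCycles n z) := by
  have h := LinearMap.congr_fun (congrArg ModuleCat.Hom.hom (HomologicalComplex.cyclesMap_i φ n)) z
  simpa only [ModuleCat.hom_comp, LinearMap.comp_apply] using h

/-- `homologyMap` on classes of cocycles (Mathlib `homologyπ_naturality`, element form).
[folklore] -/
theorem homologyMap_homologyπ (φ : C ⟶ D) (n : ℕ) (z : C.cycles n) :
    HomologicalComplex.homologyMap φ n (C.homologyπ n z) =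
      D.homologyπ n (HomologicalComplex.cyclesMap φ n z) := by
  have h := LinearMap.congr_fun
    (congrArg ModuleCat.Hom.hom (HomologicalComplex.homologyπ_naturality φ n)) z
  simpa only [ModuleCat.hom_comp, LinearMap.comp_apply] using h

/-- `toCycles w` is the cocycle `d w` (Mathlib `toCycles_i`, element form). [folklore] -/
theorem iCycles_toCycles (i j : ℕ) (w : C.X i) : C.iCycles j (C.toCycles i j w) = C.d i j w := by
  have h := LinearMap.congr_fun (congrArg ModuleCat.Hom.hom (C.toCycles_i i j)) w
  simpa only [ModuleCat.hom_comp, LinearMap.comp_apply] using h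

end ModuleComplex

/-! ### The `Hom(X_•, -)` model: elements, coboundary, factorisation through a subobject -/

section Model

variable (X : ChainComplex (Rep.{u} k G) ℕ)

/-- The coboundary of `Hom(X_•, B)` is precomposition with the differential of `X`
(definitional). [folklore] -/
theorem linearYonedaObj_d_apply (B : Rep.{u} k G) (i j : ℕ) (g : (X.linearYonedaObj k B).X i) :
    (X.linearYonedaObj k B).d i j g = (X.d j i ≫ g : X.X j ⟶ B) := rfl

/-- `postcomp` acts on elements by postcomposition (definitional). [folklore] -/
theorem postcomp_f_apply {A B : Rep.{u} k G} (f : A ⟶ B) (n : ℕ) (g : (X.linearYonedaObj k A).X n) :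
    (postcomp X f).f n g = (g ≫ f : X.X n ⟶ B) := rfl

variable {X}

/-- Postcomposition with an injective morphism of representations is injective on `Hom(Y, -)`.
[folklore] -/
theorem comp_injective_of_injective {Y A B : Rep.{u} k G} (φ : A ⟶ B)
    (hφ : Function.Injective φ.hom) {g₁ g₂ : Y ⟶ A} (h : g₁ ≫ φ = g₂ ≫ φ) : g₁ = g₂ := by
  refine Rep.hom_ext (Representation.IntertwiningMap.ext (LinearMap.ext fun y => hφ ?_))
  have := congrArg (fun (t : Y ⟶ B) => t.hom y) h
  simpa [Rep.hom_comp] using this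

/-- **Factorisation through a subobject**: a morphism from a finite free `Y ≅ k[G]^m` into `B`
whose values on the basis lie in the image of `φ : A ⟶ B` factors through `φ` (Mathlib
`Rep.freeLift`, `Rep.free_ext`). [cite: Brown1982CohomologyGroups, VIII (4.7)] -/
theorem exists_comp_eq_of_forall_exists {Y A B : Rep.{u} k G} {m : ℕ} (e : Y ≅ Rep.free k G (Fin m))
    (φ : A ⟶ B) (g : Y ⟶ B)
    (h : ∀ x : Fin m, ∃ a : A, φ.hom a =
      g.hom (e.inv.hom (Finsupp.single x (.single 1 1) : Fin m →₀ MonoidAlgebra k G))) :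
    ∃ g' : Y ⟶ A, g' ≫ φ = g := by
  choose a ha using h
  refine ⟨e.hom ≫ Rep.freeLift k G A a, ?_⟩
  have hfree : Rep.freeLift k G A a ≫ φ = e.inv ≫ g := by
    refine Rep.free_ext _ _ _ _ _ fun x => ?_
    rw [Rep.hom_comp, Rep.hom_comp]
    change φ.hom (Rep.freeLift k G A a
        (Finsupp.single x (.single 1 1) : Fin m →₀ MonoidAlgebra k G)) =
      g.hom (e.inv.hom (Finsupp.single x (.single 1 1) : Fin m →₀ MonoidAlgebra k G))
    rw [← ha x]
    congr 1
    change Representation.freeLift A.ρ a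
      (Finsupp.single x (.single 1 1) : Fin m →₀ MonoidAlgebra k G) = a x
    rw [Representation.freeLift_single_single, one_smul, map_one]
    rfl
  rw [Category.assoc, hfree, Iso.hom_inv_id_assoc]

end Model

/-! ### Directed unions of coefficients in the `Hom(X_•, -)` model -/

section Union

variable {ι : Type*} [Preorder ι] [IsDirected ι (· ≤ ·)] [Nonempty ι]
variable (X : ChainComplex (Rep.{u} k G) ℕ)
  (hX : ∀ i, ∃ m : ℕ, Nonempty (X.X i ≅ Rep.free k G (Fin m)))
  {A : ι → Rep.{u} k G} {B : Rep.{u} k G} (φ : ∀ i, A i ⟶ B)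
  (hinj : ∀ i, Function.Injective (φ i).hom)
  (t : ∀ ⦃i j⦄, i ≤ j → (A i ⟶ A j)) (ht : ∀ ⦃i j⦄ (h : i ≤ j), t h ≫ φ j = φ i)
  (hcov : ∀ b : B, ∃ i, ∃ a : A i, (φ i).hom a = b)

include hX ht hcov in
/-- Every morphism from a finite free term of `X` into the directed union factors through a member
(its finitely many basis values lie in a common `A_i`).
[cite: Brown1982CohomologyGroups, VIII (4.7)] -/
theorem exists_index_comp_eq (n : ℕ) (g : X.X n ⟶ B) : ∃ i, ∃ g' : X.X n ⟶ A i, g' ≫ φ i = g := by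
  classical
  obtain ⟨m, ⟨e⟩⟩ := hX n
  -- one index per basis vector, and a common upper bound
  choose i₀ a ha using fun x : Fin m =>
    hcov (g.hom (e.inv.hom (Finsupp.single x (.single 1 1) : Fin m →₀ MonoidAlgebra k G)))
  obtain ⟨l, hl⟩ := Finset.exists_le (Finset.univ.image i₀)
  refine ⟨l, exists_comp_eq_of_forall_exists e (φ l) g fun x => ?_⟩
  refine ⟨(t (hl _ (Finset.mem_image_of_mem i₀ (Finset.mem_univ x)))).hom (a x), ?_⟩
  rw [← ha x, ← ht (hl _ (Finset.mem_image_of_mem i₀ (Finset.mem_univ x))), Rep.comp_apply]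

include hX hinj ht hcov in
/-- **Surjectivity in the `Hom(X_•, -)` model**: every class of `Hⁿ(Hom(X_•, B))` comes from some
`Hⁿ(Hom(X_•, A_i))` when the terms of `X` are finite free.
[cite: Brown1982CohomologyGroups, VIII (4.6)] -/
theorem exists_homologyMap_postcomp_eq (n : ℕ) (x : (X.linearYonedaObj k B).homology n) :
    ∃ i, ∃ y : (X.linearYonedaObj k (A i)).homology n,
      HomologicalComplex.homologyMap (postcomp X (φ i)) n y = x := by
  obtain ⟨z, rfl⟩ := homologyπ_surjective _ n x
  -- the cocycle `g : X_n ⟶ B`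
  set g : (X.linearYonedaObj k B).X n := (X.linearYonedaObj k B).iCycles n z with hg
  have hdg : (X.linearYonedaObj k B).d n (n + 1) g = 0 := by
    have h := LinearMap.congr_fun (congrArg ModuleCat.Hom.hom
      ((X.linearYonedaObj k B).iCycles_d n (n + 1))) z
    simpa only [ModuleCat.hom_comp, LinearMap.comp_apply, ModuleCat.hom_zero,
      LinearMap.zero_apply] using h
  obtain ⟨i, g', hg'⟩ := exists_index_comp_eq X hX φ t ht hcov n g
  -- `g'` is a cocycle
  have hdg' : (X.linearYonedaObj k (A i)).d n (n + 1) g' = 0 := by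
    rw [linearYonedaObj_d_apply] at hdg ⊢
    refine comp_injective_of_injective (φ i) (hinj i) ?_
    rw [Category.assoc, hg']
    change _ = (0 : X.X (n + 1) ⟶ A i) ≫ φ i
    rw [Limits.zero_comp]
    exact hdg
  obtain ⟨z', hz'⟩ := exists_cycles_of_d_eq_zero (X.linearYonedaObj k (A i)) n g' hdg'
  refine ⟨i, (X.linearYonedaObj k (A i)).homologyπ n z', ?_⟩
  rw [homologyMap_homologyπ]
  congr 1
  refine iCycles_injective _ n ?_
  rw [iCycles_cyclesMap, hz', postcomp_f_apply, hg']

include hX hinj ht hcov in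
/-- **Injectivity in the `Hom(X_•, -)` model**: a class of `Hⁿ(Hom(X_•, A_i))` vanishing in
`Hⁿ(Hom(X_•, B))` vanishes in some `Hⁿ(Hom(X_•, A_j))`, `j ≥ i`, when the terms of `X` are finite
free. [cite: Brown1982CohomologyGroups, VIII (4.6)] -/
theorem exists_homologyMap_postcomp_eq_zero (n : ℕ) (i : ι)
    (y : (X.linearYonedaObj k (A i)).homology n)
    (hy : HomologicalComplex.homologyMap (postcomp X (φ i)) n y = 0) :
    ∃ j, ∃ h : i ≤ j, HomologicalComplex.homologyMap (postcomp X (t h)) n y = 0 := by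
  obtain ⟨z, rfl⟩ := homologyπ_surjective _ n y
  rw [homologyMap_homologyπ, homologyπ_apply_eq_zero_iff] at hy
  obtain ⟨w, hw⟩ := hy
  -- `w : X_{n-1} ⟶ B` factors through some `A j`, `j ≥ i`
  obtain ⟨j₀, w₀, hw₀⟩ := exists_index_comp_eq X hX φ t ht hcov (n - 1) w
  obtain ⟨j, hij, hj₀j⟩ := directed_of (· ≤ ·) i j₀
  -- `d w = z ≫ φ i` in `Hom(X_•, B)`
  have key : (X.d n (n - 1) ≫ w : X.X n ⟶ B) =
      ((X.linearYonedaObj k (A i)).iCycles n z : X.X n ⟶ A i) ≫ φ i := by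
    have h1 := congrArg ((X.linearYonedaObj k B).iCycles n) hw
    rw [iCycles_toCycles, iCycles_cyclesMap] at h1
    exact h1
  refine ⟨j, hij, ?_⟩
  rw [homologyMap_homologyπ, homologyπ_apply_eq_zero_iff]
  refine ⟨(w₀ ≫ t hj₀j : X.X (n - 1) ⟶ A j), iCycles_injective _ n ?_⟩
  rw [iCycles_toCycles, iCycles_cyclesMap]
  change (X.d n (n - 1) ≫ (w₀ ≫ t hj₀j) : X.X n ⟶ A j) =
    ((X.linearYonedaObj k (A i)).iCycles n z : X.X n ⟶ A i) ≫ t hij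
  refine comp_injective_of_injective (φ j) (hinj j) ?_
  simp only [Category.assoc, ht]
  rw [hw₀]
  exact key

end Union

/-! ### Transfer to `groupCohomology` -/

section Transfer

variable {ι : Type*} [Preorder ι] [IsDirected ι (· ≤ ·)] [Nonempty ι]
  (P : ProjectiveResolution (Rep.trivial k G k))
  (hP : ∀ i, ∃ m : ℕ, Nonempty (P.complex.X i ≅ Rep.free k G (Fin m)))
  {A : ι → Rep.{u} k G} {B : Rep.{u} k G} (φ : ∀ i, A i ⟶ B)
  (hinj : ∀ i, Function.Injective (φ i).hom)
  (t : ∀ ⦃i j⦄, i ≤ j → (A i ⟶ A j)) (ht : ∀ ⦃i j⦄ (h : i ≤ j), t h ≫ φ j = φ i)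
  (hcov : ∀ b : B, ∃ i, ∃ a : A i, (φ i).hom a = b)

/-- Element form of the naturality of `resolutionIso`. [folklore] -/
theorem resolutionIso_hom_apply_map {A B : Rep.{u} k G} (f : A ⟶ B) (n : ℕ)
    (y : groupCohomology A n) :
    (resolutionIso P B n).hom (groupCohomology.map (MonoidHom.id G) f n y) =
      HomologicalComplex.homologyMap (postcomp P.complex f) n ((resolutionIso P A n).hom y) := by
  have h := LinearMap.congr_fun (congrArg ModuleCat.Hom.hom (resolutionIso_hom_naturality P f n)) y
  simp only [ModuleCat.hom_comp, LinearMap.comp_apply] at h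
  exact h.symm

include hP hinj ht hcov in
/-- **`Hⁿ(G, -)` commutes with directed unions, surjectivity half** (for `G` of type `FP_∞`:
`P_n ≅ k[G]^{m_n}` for all `n`): every class of `Hⁿ(G, B)` comes from `Hⁿ(G, A_i)` for some member
`A_i` of a directed family of subrepresentations (`φ_i : A_i ↪ B` injective, transition maps `t`)
exhausting `B` (Brown VIII (4.6): "If `M` is of type `FP_∞` then `Ext*_R(M, -)` commutes with
direct limits"; Serre 1971 §1.8 Remarque). [cite: Brown1982CohomologyGroups, VIII (4.6)]
[cite: Serre1971CohomologieGroupesDiscrets, §1.8 Remarque] -/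
theorem exists_map_eq_of_directed (n : ℕ) (x : groupCohomology B n) :
    ∃ i, ∃ y : groupCohomology (A i) n, groupCohomology.map (MonoidHom.id G) (φ i) n y = x := by
  obtain ⟨i, y', hy'⟩ := exists_homologyMap_postcomp_eq P.complex hP φ hinj t ht hcov n
    ((resolutionIso P B n).hom x)
  refine ⟨i, (resolutionIso P (A i) n).inv y', ?_⟩
  apply (resolutionIso P B n).toLinearEquiv.injective
  change (resolutionIso P B n).hom _ = (resolutionIso P B n).hom x
  rw [resolutionIso_hom_apply_map, ← hy']
  congr 1
  exact LinearMap.congr_fun (congrArg ModuleCat.Hom.hom (resolutionIso P (A i) n).inv_hom_id) y'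

include hP hinj ht hcov in
/-- **`Hⁿ(G, -)` commutes with directed unions, injectivity half** (for `G` of type `FP_∞`): a class
of `Hⁿ(G, A_i)` that dies in `Hⁿ(G, B)` already dies in `Hⁿ(G, A_j)` for some `j ≥ i`.
[cite: Brown1982CohomologyGroups, VIII (4.6)]
[cite: Serre1971CohomologieGroupesDiscrets, §1.8 Remarque] -/
theorem exists_map_eq_zero_of_directed (n : ℕ) (i : ι) (y : groupCohomology (A i) n)
    (hy : groupCohomology.map (MonoidHom.id G) (φ i) n y = 0) :
    ∃ j, ∃ h : i ≤ j, groupCohomology.map (MonoidHom.id G) (t h) n y = 0 := by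
  have hy' : HomologicalComplex.homologyMap (postcomp P.complex (φ i)) n
      ((resolutionIso P (A i) n).hom y) = 0 := by
    rw [← resolutionIso_hom_apply_map, hy, map_zero]
  obtain ⟨j, hij, hj⟩ := exists_homologyMap_postcomp_eq_zero P.complex hP φ hinj t ht hcov n i _ hy'
  refine ⟨j, hij, ?_⟩
  apply (resolutionIso P (A j) n).toLinearEquiv.injective
  change (resolutionIso P (A j) n).hom _ = (resolutionIso P (A j) n).hom 0
  rw [resolutionIso_hom_apply_map, hj, map_zero]

end Transfer

end ResolutionComparison

end Literature.Algebra.Homology
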